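import Mathlib
import HarnessLib
import Summits.NavierStokesRegularity.NavierStokesRegularity.Theorems.PoloidalWindowDoorPoloidalWindowRigidityTimeHeightShearPressure
import Summits.NavierStokesRegularity.NavierStokesRegularity.Theorems.PoloidalWindowDoorPoloidalWindowRigidityTimeHeightShearLinearSlice
import Summits.NavierStokesRegularity.NavierStokesRegularity.Theorems.PoloidalWindowDoorLrcModEntireTwistingTHFlatRidgeThirdJet
import Summits.NavierStokesRegularity.NavierStokesRegularity.Theorems.PoloidalWindowDoorLrcModEntireSheetFlattenTools
import Summits.NavierStokesRegularity.NavierStokesRegularity.Theorems.PoloidalWindowDoorLrcModEntireRidgeWebDynamics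
import Literature.Analysis.FluidPDE.SteadyLiouvilleTsaiKit

/-!
# Route `PoloidalWindowDoor`, item `LrcModEntire` (stmt-NavierStokesRegularity-20428), cell (Q4-sonic), slot `stub_Q4sonicLineNeg`, case I —
# S4c (class-free piece): ON THE (TH) SLAB THE LAPLACIAN OF `g = ∂_e u₂` IS `(1 − μ)·Δₕ g`

Cell ns-regularity-ideate, helper seat ns-k2-port-2 g8 under the LEAD of item 20428 (ns-poloidal-K2-p3 g17, memo `T2B-g17.md` v4 §7 S4: «`Δg = (1−μ)Δₕg` from the slab
law for g»); `--supports stmt-NavierStokesRegularity-20428 --as helper`.  Class-free (one slice).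

* ★ `laplacian_horizDeriv_two` — `u ∈ C^∞(ℝ³, ℝ³)` divergence-free (coordinate form), the slab law `∂₂u_b = m(y₂)·∂_bu₂` (`b = 0,1`) on the open slab `|y₂| < ρ`
  with `m` differentiable, `e` horizontal, `|x₂| < ρ`.  Then with `g := ∂_e u₂ = (y ↦ Du(y)[e]₂)`:
  **`Δg(x) = (1 − m(x₂))·(∂₀∂₀g + ∂₁∂₁g)(x)`** — the plane-wave identity `∂₂∂₂u₂ = −m(y₂)Δₕu₂` (`…TimeHeightShearLinearSlice.plane_wave_identity`)
  differentiated along the horizontal direction `e` (the factor `m(y₂)` is constant along `e`), plus Schwarz for `D³u₂`.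
Use: turns `Δg` in port-2's `…HorizDerivTransportLaw.horizDeriv_two_transport_law` into `(1−μ)(g_ss + g_mm)` in the sheared coordinates of `…ShearedCoordinates`
(`pd_tgS_pd_tgS_comp_shearMap`, `pd_dN_pd_dN_comp_shearMap`, `bilin_frame_trace`).
WHAT THIS IS NOT: not a claim about Navier–Stokes regularity; no stub is closed here; items 20428 / 19708 / 27893 OPEN.
-/

noncomputable section

set_option linter.dupNamespace false
set_option linter.style.longLine false

namespace Summit.NavierStokesRegularity.NavierStokesRegularity.Theorems.PoloidalWindowDoorLrcModEntireHorizDerivLaplacianSplit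

open Set Function Filter Topology Metric
open scoped RealInnerProductSpace InnerProductSpace Laplacian ContDiff
open Literature.Analysis Literature.Analysis.FluidPDE Literature.Analysis.FluidPDE.Tsai2021
open Summit.NavierStokesRegularity.NavierStokesRegularity.Theorems.PoloidalWindowDoorPoloidalWindowRigidityTimeHeightShearPressure
open Summit.NavierStokesRegularity.NavierStokesRegularity.Theorems.PoloidalWindowDoorPoloidalWindowRigidityTimeHeightShearLinearSlice
open Summit.NavierStokesRegularity.NavierStokesRegularity.Theorems.PoloidalWindowDoorLrcModEntireTwistingTHFlatRidgeThirdJet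
open Summit.NavierStokesRegularity.NavierStokesRegularity.Theorems.PoloidalWindowDoorLrcModEntireSheetFlattenTools
open Summit.NavierStokesRegularity.NavierStokesRegularity.Theorems.PoloidalWindowDoorLrcModEntireRidgeWebDynamics

/-- `D(y ↦ D²θ(y)[b][c])(x)[a] = D³θ(x)[a][b][c]` when `D²θ` is differentiable at `x`. -/
theorem fderiv_fderiv_fderiv_apply {E : Type*} [NormedAddCommGroup E] [NormedSpace ℝ E] {θ : E → ℝ} {x : E}
    (hθ : DifferentiableAt ℝ (fderiv ℝ (fderiv ℝ θ)) x) (a b c : E) :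
    fderiv ℝ (fun y => fderiv ℝ (fderiv ℝ θ) y b c) x a = fderiv ℝ (fderiv ℝ (fderiv ℝ θ)) x a b c := by
  have hF : DifferentiableAt ℝ (fun y => fderiv ℝ (fderiv ℝ θ) y b) x := hθ.clm_apply (differentiableAt_const b)
  rw [fderiv_clm_apply hF (differentiableAt_const c)]
  simp only [fderiv_fun_const, Pi.zero_apply, ContinuousLinearMap.comp_zero, zero_add, ContinuousLinearMap.flip_apply]
  rw [fderiv_clm_apply hθ (differentiableAt_const b)]
  simp

/-- ★ **`Δ(∂_e u₂) = (1 − m)·Δₕ(∂_e u₂)` on the (TH) slab.**  See the module docstring. -/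
theorem laplacian_horizDeriv_two {u : EuclideanSpace ℝ (Fin 3) → EuclideanSpace ℝ (Fin 3)} (hu : ContDiff ℝ ∞ u)
    (hdiv : ∀ y, fderiv ℝ u y (EuclideanSpace.single 0 (1 : ℝ)) 0 + fderiv ℝ u y (EuclideanSpace.single 1 (1 : ℝ)) 1 +
      fderiv ℝ u y (EuclideanSpace.single 2 (1 : ℝ)) 2 = 0)
    {m : ℝ → ℝ} {ρ : ℝ} (hm : ∀ z : ℝ, |z| < ρ → DifferentiableAt ℝ m z)
    (hslab : ∀ y : EuclideanSpace ℝ (Fin 3), |y 2| < ρ → ∀ b : Fin 3, b ≠ 2 →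
      fderiv ℝ u y (EuclideanSpace.single 2 (1 : ℝ)) b = m (y 2) * fderiv ℝ u y (EuclideanSpace.single b (1 : ℝ)) 2)
    {e : EuclideanSpace ℝ (Fin 3)} (he2 : e 2 = 0) {x : EuclideanSpace ℝ (Fin 3)} (hx : |x 2| < ρ) :
    Δ (fun y => fderiv ℝ u y e 2) x =
      (1 - m (x 2)) * (fderiv ℝ (fun y => fderiv ℝ (fun y' => fderiv ℝ u y' e 2) y (EuclideanSpace.single 0 (1 : ℝ))) x (EuclideanSpace.single 0 (1 : ℝ)) +
        fderiv ℝ (fun y => fderiv ℝ (fun y' => fderiv ℝ u y' e 2) y (EuclideanSpace.single 1 (1 : ℝ))) x (EuclideanSpace.single 1 (1 : ℝ))) := by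
  set E0 : EuclideanSpace ℝ (Fin 3) := EuclideanSpace.single 0 (1 : ℝ) with hE0
  set E1 : EuclideanSpace ℝ (Fin 3) := EuclideanSpace.single 1 (1 : ℝ) with hE1
  set E2 : EuclideanSpace ℝ (Fin 3) := EuclideanSpace.single 2 (1 : ℝ) with hE2
  set θ : EuclideanSpace ℝ (Fin 3) → ℝ := fun y => u y 2 with hθ_def
  have hθ : ContDiff ℝ ∞ θ := (contDiff_piLp_apply (p := 2) (𝕜 := ℝ) (E := fun _ : Fin 3 => ℝ) (i := (2 : Fin 3))).comp hu
  have hθ2 : ContDiff ℝ 2 θ := hθ.of_le (by norm_cast)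
  have hθ3 : ∀ y, ContDiffAt ℝ 3 θ y := fun y => (hθ.of_le (by norm_cast)).contDiffAt
  have hud : Differentiable ℝ u := hu.differentiable (by simp)
  have hDθd : Differentiable ℝ (fderiv ℝ θ) := (hθ.fderiv_right (m := ∞) (by norm_cast)).differentiable (by simp)
  have hD2θ : ContDiff ℝ ∞ (fderiv ℝ (fderiv ℝ θ)) :=
    (hθ.fderiv_right (m := ∞) (by norm_cast)).fderiv_right (m := ∞) (by norm_cast)
  have hD2θd : Differentiable ℝ (fderiv ℝ (fderiv ℝ θ)) := hD2θ.differentiable (by simp)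
  -- the function `g = ∂_e u₂ = (y ↦ Dθ(y)[e])`
  have hcoord : ∀ y w, fderiv ℝ u y w 2 = fderiv ℝ θ y w := fun y w => by
    have h := ((EuclideanSpace.proj (𝕜 := ℝ) (2 : Fin 3)).hasFDerivAt.comp y (hud y).hasFDerivAt).fderiv
    have e3 : (⇑(EuclideanSpace.proj (𝕜 := ℝ) (2 : Fin 3)) ∘ u) = θ := by funext y'; simp [hθ_def]
    rw [e3] at h
    rw [h]; rfl
  have hg : (fun y => fderiv ℝ u y e 2) = fun y => fderiv ℝ θ y e := by funext y; exact hcoord y e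
  set g : EuclideanSpace ℝ (Fin 3) → ℝ := fun y => fderiv ℝ θ y e with hg_def
  have hgs : ContDiff ℝ ∞ g := (hθ.fderiv_right (m := ∞) (by norm_cast)).clm_apply contDiff_const
  have hg2 : ContDiff ℝ 2 g := hgs.of_le (by norm_cast)
  -- `Dg(y)[w] = D²θ(y)[w][e]` and `D²g(x)[a][b] = D³θ(x)[a][b][e]`
  have hDg : ∀ y w, fderiv ℝ g y w = fderiv ℝ (fderiv ℝ θ) y w e := fun y w => fderiv_partial_apply' (hDθd y) e w
  set D3 := fderiv ℝ (fderiv ℝ (fderiv ℝ θ)) x with hD3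
  have hD2g : ∀ a b, fderiv ℝ (fun y => fderiv ℝ g y b) x a = D3 a b e := by
    intro a b
    have hfun : (fun y => fderiv ℝ g y b) = fun y => fderiv ℝ (fderiv ℝ θ) y b e := by funext y; exact hDg y b
    rw [hfun, fderiv_fderiv_fderiv_apply (hD2θd x)]
  -- Schwarz for `D³θ(x)`
  have h12 : ∀ a b c, D3 a b c = D3 b a c := fun a b c => thirdDeriv_symm₁₂ (hθ3 x) a b c
  have h23 : ∀ a b c, D3 a b c = D3 a c b := fun a b c => thirdDeriv_symm₂₃ (hθ3 x) a b c
  have hiie : ∀ a, D3 a a e = D3 e a a := fun a => by rw [h23 a a e, h12 a e a]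
  -- `Δg(x) = Σᵢ D³θ(x)[e][êᵢ][êᵢ]`
  have hΔ : Δ (fun y => fderiv ℝ u y e 2) x = D3 e E0 E0 + D3 e E1 E1 + D3 e E2 E2 := by
    rw [hg, laplacian_eq_sum_three hg2 x, Fin.sum_univ_three, hD2g, hD2g, hD2g, hiie, hiie, hiie]
  -- the plane-wave identity on the slab, as an identity of functions near `x`
  have hS : {y : EuclideanSpace ℝ (Fin 3) | |y 2| < ρ} ∈ 𝓝 x :=
    (isOpen_lt (continuous_abs.comp ((EuclideanSpace.proj (𝕜 := ℝ) (2 : Fin 3)).continuous)) continuous_const).mem_nhds hx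
  have hpw : (fun y => fderiv ℝ (fderiv ℝ θ) y E2 E2 + m (y 2) * (fderiv ℝ (fderiv ℝ θ) y E0 E0 + fderiv ℝ (fderiv ℝ θ) y E1 E1)) =ᶠ[𝓝 x]
      fun _ => (0 : ℝ) := by
    filter_upwards [hS] with y hy
    have hplane : ∀ y' : EuclideanSpace ℝ (Fin 3), y' 2 = y 2 → ∀ b : Fin 3, b ≠ 2 →
        fderiv ℝ u y' (EuclideanSpace.single 2 (1 : ℝ)) b = m (y 2) * fderiv ℝ u y' (EuclideanSpace.single b (1 : ℝ)) 2 := by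
      intro y' hy' b hb
      have h := hslab y' (by rw [hy']; exact hy) b hb
      rw [hy'] at h; exact h
    have h := plane_wave_identity (hu.of_le (by norm_cast)) hdiv hplane (x := y) rfl
    rw [nested_eq_fderiv_fderiv hθ2, nested_eq_fderiv_fderiv hθ2, nested_eq_fderiv_fderiv hθ2] at h
    rw [h]; ring
  -- differentiate it along `e` at `x`
  have hmx : DifferentiableAt ℝ m (x 2) := hm _ hx
  have hA : ∀ a, HasFDerivAt (fun y => fderiv ℝ (fderiv ℝ θ) y a a) (fderiv ℝ (fun y => fderiv ℝ (fderiv ℝ θ) y a a) x) x := fun a => by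
    have hc : ContDiff ℝ ∞ (fun y => fderiv ℝ (fderiv ℝ θ) y a a) := (hD2θ.clm_apply contDiff_const).clm_apply contDiff_const
    exact ((hc.differentiable (by simp)) x).hasFDerivAt
  have hM : HasFDerivAt (fun y : EuclideanSpace ℝ (Fin 3) => m (y 2)) (fderiv ℝ (fun y : EuclideanSpace ℝ (Fin 3) => m (y 2)) x) x :=
    (hasFDerivAt_comp_height hmx.hasDerivAt).differentiableAt.hasFDerivAt
  have hsum := (hA E2).fun_add (hM.fun_mul ((hA E0).fun_add (hA E1)))
  have hzero : HasFDerivAt (fun y => fderiv ℝ (fderiv ℝ θ) y E2 E2 + m (y 2) * (fderiv ℝ (fderiv ℝ θ) y E0 E0 + fderiv ℝ (fderiv ℝ θ) y E1 E1))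
      (0 : EuclideanSpace ℝ (Fin 3) →L[ℝ] ℝ) x := (hasFDerivAt_const (0 : ℝ) x).congr_of_eventuallyEq hpw
  have hkey := congrArg (fun L : EuclideanSpace ℝ (Fin 3) →L[ℝ] ℝ => L e) (hsum.unique hzero)
  simp only [add_apply, smul_apply, smul_eq_mul] at hkey
  have h0 : ((0 : EuclideanSpace ℝ (Fin 3) →L[ℝ] ℝ) : EuclideanSpace ℝ (Fin 3) → ℝ) e = 0 := rfl
  rw [fderiv_fderiv_fderiv_apply (hD2θd x), fderiv_fderiv_fderiv_apply (hD2θd x), fderiv_fderiv_fderiv_apply (hD2θd x),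
    fderiv_comp_height_apply hmx, h0] at hkey
  simp only [he2, mul_zero, add_zero] at hkey
  -- assemble: `D³θ[e][ê₂][ê₂] = −m·(D³θ[e][ê₀][ê₀] + D³θ[e][ê₁][ê₁])`
  rw [hΔ, hg, hD2g, hD2g, ← h12 E0 E0 e, ← h12 E1 E1 e, h23 E0 E0 e, h23 E1 E1 e, h12 E0 e E0, h12 E1 e E1]
  rw [← hD3] at hkey
  linear_combination hkey

end Summit.NavierStokesRegularity.NavierStokesRegularity.Theorems.PoloidalWindowDoorLrcModEntireHorizDerivLaplacianSplit
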